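import Summits.NavierStokesRegularity.NavierStokesRegularity.Theorems.OddMorawetzLocal.Negative.OddMorawetzLocalJetAlgebra
import HarnessLib

/-!
# Crux `OddMorawetzLocal` (stmt-NavierStokesRegularity-1376), refutation — calculus of jet-polynomial densities

Stub `dens_calculus` of the refutation skeleton of the line `registered` (lead c1).  In the refutation every
admissible density is, on symmetric jets, `JPoly.dens p` for a sparse jet polynomial `p : JPoly ℝ`
(`Theorems/OddMorawetzLocal/Negative/OddMorawetzLocalJetAlgebra.lean`); the crux's clauses on a density `m`
(smoothness, cubic homogeneity `m (μ z) = μ³ m z`, derivative weight `k`) and its Euler-derivative integrand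
`fderiv m (Jv x) (Jb x)` have to be read off from `p`.  This file supplies:

* `contDiff_dens` — `dens p` is `C^∞` (finite sum of products of the continuous linear jet coordinates `JVar.coord v`);
* `fderiv_dens_apply` — its Fréchet derivative is the linearisation `JPoly.lin` (Leibniz rule along each monomial,
  `JPoly.prodDeriv`);
* `dens_smul` — cubic homogeneity when every monomial has three variables;
* `dens_weight` — weight-`k` homogeneity under the jet scaling `(z₀, s z₁, s² z₂, s³ z₃)` when every monomial has
  derivative weight `monoWeight = k`;
* `jetVal_eq_coord` — the abstract coordinates of the jet `(u x, Du x, D²u x, D³u x)` of a field are its partial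
  derivatives `jetVal u x` (orders `≤ 3`);
* `coord_eq_zero_of_le_length` — coordinates of order `≥ 4` vanish on 3-jets;

assembled as `dens_calculus`.  Elementary calculus over Mathlib (`ContinuousLinearMap.hasFDerivAt`,
`HasFDerivAt.fun_mul`, inductions on lists); no named facts, no new axioms.
-/

noncomputable section

set_option linter.dupNamespace false
set_option autoImplicit false

namespace Summit.NavierStokesRegularity.NavierStokesRegularity.Theorems.OddMorawetz

/-! ### Unfolding the density of a polynomial -/

/-- The density of the empty polynomial is zero. -/
theorem dens_nil : JPoly.dens ([] : JPoly ℝ) = fun _ => 0 := by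
  funext z
  simp [JPoly.dens, JPoly.evalA]

/-- The density of `t :: p` is the monomial density of `t` plus the density of `p`. -/
theorem dens_cons (t : ℝ × List JVar) (p : JPoly ℝ) :
    JPoly.dens (t :: p) = fun z => t.1 * (t.2.map fun v => JVar.coord v z).prod + JPoly.dens p z := by
  funext z
  simp [JPoly.dens, JPoly.evalA]

/-! ### Smoothness -/

/-- A monomial in the jet coordinates is smooth. -/
theorem contDiff_monomial (m : List JVar) :
    ContDiff ℝ (⊤ : ℕ∞) (fun z : Jet3 => (m.map fun v => JVar.coord v z).prod) := by
  induction m with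
  | nil => simpa using contDiff_const (c := (1 : ℝ))
  | cons v vs ih =>
    simpa [List.map_cons, List.prod_cons] using (JVar.coord v).contDiff.mul ih

/-- **Smoothness**: the density of a jet polynomial is `C^∞`. -/
theorem contDiff_dens (p : JPoly ℝ) : ContDiff ℝ (⊤ : ℕ∞) (JPoly.dens p) := by
  induction p with
  | nil => rw [dens_nil]; exact contDiff_const
  | cons t p ih =>
    rw [dens_cons]
    exact (contDiff_const.mul (contDiff_monomial t.2)).add ih

/-! ### The derivative is the linearisation -/

/-- Leibniz rule along a monomial: the derivative of `z ↦ Π_{v ∈ m} coord v z` at `z` in the direction `w` is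
`prodDeriv m (coord · z) (coord · w)`. -/
theorem hasFDerivAt_monomial (m : List JVar) (z : Jet3) :
    ∃ D : Jet3 →L[ℝ] ℝ, HasFDerivAt (fun z : Jet3 => (m.map fun v => JVar.coord v z).prod) D z ∧
      ∀ w, D w = JPoly.prodDeriv m (fun v => JVar.coord v z) (fun v => JVar.coord v w) := by
  induction m with
  | nil =>
    exact ⟨0, by simpa using hasFDerivAt_const (1 : ℝ) z, fun w => by simp [JPoly.prodDeriv]⟩
  | cons v vs ih =>
    obtain ⟨D, hD, hDw⟩ := ih
    refine ⟨JVar.coord v z • D + (vs.map fun v => JVar.coord v z).prod • JVar.coord v, ?_, fun w => ?_⟩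
    · simpa [List.map_cons, List.prod_cons] using ((JVar.coord v).hasFDerivAt (x := z)).fun_mul hD
    · simp only [_root_.add_apply, _root_.smul_apply, smul_eq_mul, hDw,
        JPoly.prodDeriv]
      ring

/-- The derivative of the density of a polynomial exists and is its linearisation. -/
theorem hasFDerivAt_dens (p : JPoly ℝ) (z : Jet3) :
    ∃ D : Jet3 →L[ℝ] ℝ, HasFDerivAt (JPoly.dens p) D z ∧
      ∀ w, D w = JPoly.lin p (fun v => JVar.coord v z) (fun v => JVar.coord v w) := by
  induction p with
  | nil =>
    exact ⟨0, by rw [dens_nil]; exact hasFDerivAt_const (0 : ℝ) z, fun w => by simp [JPoly.lin]⟩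
  | cons t p ih =>
    obtain ⟨D, hD, hDw⟩ := ih
    obtain ⟨D', hD', hDw'⟩ := hasFDerivAt_monomial t.2 z
    refine ⟨t.1 • D' + D, ?_, fun w => ?_⟩
    · rw [dens_cons]
      exact (hD'.const_mul t.1).add hD
    · simp only [_root_.add_apply, _root_.smul_apply, smul_eq_mul, hDw, hDw',
        JPoly.lin, List.map_cons, List.sum_cons]

/-- **The derivative is the linearisation**: `D(dens p)(z)[w] = lin p (coord · z) (coord · w)`. -/
theorem fderiv_dens_apply (p : JPoly ℝ) (z w : Jet3) :
    fderiv ℝ (JPoly.dens p) z w = JPoly.lin p (fun v => JVar.coord v z) (fun v => JVar.coord v w) := by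
  obtain ⟨D, hD, hDw⟩ := hasFDerivAt_dens p z
  rw [hD.fderiv, hDw]

/-! ### Homogeneities -/

/-- Scaling of a monomial: if every variable is rescaled by `s ^ wt v`, the monomial is rescaled by
`s ^ Σ wt`. -/
theorem prod_map_scale (m : List JVar) (wt : JVar → ℕ) (s : ℝ) (ζ ζ' : JVar → ℝ)
    (hζ : ∀ v, ζ' v = s ^ wt v * ζ v) :
    (m.map ζ').prod = s ^ (m.map wt).sum * (m.map ζ).prod := by
  induction m with
  | nil => simp
  | cons v vs ih =>
    simp only [List.map_cons, List.prod_cons, List.sum_cons, ih, hζ, pow_add]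
    ring

/-- Scaling of a polynomial all of whose monomials have the same total `wt`-weight `k`. -/
theorem evalA_scale (p : JPoly ℝ) (wt : JVar → ℕ) (k : ℕ) (s : ℝ) (ζ ζ' : JVar → ℝ)
    (hζ : ∀ v, ζ' v = s ^ wt v * ζ v) (hp : ∀ t ∈ p, (t.2.map wt).sum = k) :
    JPoly.evalA p ζ' = s ^ k * JPoly.evalA p ζ := by
  induction p with
  | nil => simp [JPoly.evalA]
  | cons t p ih =>
    have ht : (t.2.map wt).sum = k := hp t (by simp)
    have ih' := ih fun t' ht' => hp t' (by simp [ht'])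
    simp only [JPoly.evalA, List.map_cons, List.sum_cons] at ih' ⊢
    rw [ih', prod_map_scale t.2 wt s ζ ζ' hζ, ht]
    ring

/-- **Cubic homogeneity**: if every monomial of `p` has exactly three variables, `dens p (μ z) = μ³ dens p z`. -/
theorem dens_smul (p : JPoly ℝ) (hp : ∀ t ∈ p, t.2.length = 3) (μ : ℝ) (z : Jet3) :
    JPoly.dens p (μ • z) = μ ^ 3 * JPoly.dens p z := by
  have hsum : ∀ m : List JVar, (m.map fun _ => (1 : ℕ)).sum = m.length := by
    intro m
    induction m with
    | nil => simp
    | cons v vs ih => simp only [List.map_cons, List.sum_cons, ih, List.length_cons]; omega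
  refine evalA_scale p (fun _ => 1) 3 μ (fun v => JVar.coord v z) (fun v => JVar.coord v (μ • z))
    (fun v => ?_) (fun t ht => ?_)
  · rw [map_smul, smul_eq_mul, pow_one]
  · rw [hsum, hp t ht]

/-- The jet scaling `(z₀, s z₁, s² z₂, s³ z₃)` rescales the coordinate `∂^α v_a` by `s ^ |α|`. -/
theorem coord_scale (v : JVar) (s : ℝ) (z₀ : EuclideanSpace ℝ (Fin 3))
    (z₁ : EuclideanSpace ℝ (Fin 3) [×1]→L[ℝ] EuclideanSpace ℝ (Fin 3))
    (z₂ : EuclideanSpace ℝ (Fin 3) [×2]→L[ℝ] EuclideanSpace ℝ (Fin 3))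
    (z₃ : EuclideanSpace ℝ (Fin 3) [×3]→L[ℝ] EuclideanSpace ℝ (Fin 3)) :
    JVar.coord v ((z₀, s • z₁, (s ^ 2) • z₂, (s ^ 3) • z₃) : Jet3) =
      s ^ v.2.length * JVar.coord v ((z₀, z₁, z₂, z₃) : Jet3) := by
  obtain ⟨a, l⟩ := v
  match l with
  | [] => simp [JVar.coord]
  | [i] => simp [JVar.coord]
  | [i, j] => simp [JVar.coord]
  | [i, j, k] => simp [JVar.coord]
  | _ :: _ :: _ :: _ :: _ => simp [JVar.coord]

/-- **Weight homogeneity**: if every monomial of `p` has derivative weight `k`, then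
`dens p (z₀, s z₁, s² z₂, s³ z₃) = s ^ k dens p (z₀, z₁, z₂, z₃)`. -/
theorem dens_weight (p : JPoly ℝ) (k : ℕ) (hp : ∀ t ∈ p, monoWeight t.2 = k) (s : ℝ)
    (z₀ : EuclideanSpace ℝ (Fin 3)) (z₁ : EuclideanSpace ℝ (Fin 3) [×1]→L[ℝ] EuclideanSpace ℝ (Fin 3))
    (z₂ : EuclideanSpace ℝ (Fin 3) [×2]→L[ℝ] EuclideanSpace ℝ (Fin 3))
    (z₃ : EuclideanSpace ℝ (Fin 3) [×3]→L[ℝ] EuclideanSpace ℝ (Fin 3)) :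
    JPoly.dens p (z₀, s • z₁, (s ^ 2) • z₂, (s ^ 3) • z₃) = s ^ k * JPoly.dens p (z₀, z₁, z₂, z₃) :=
  evalA_scale p (fun v => v.2.length) k s (fun v => JVar.coord v ((z₀, z₁, z₂, z₃) : Jet3))
    (fun v => JVar.coord v ((z₀, s • z₁, (s ^ 2) • z₂, (s ^ 3) • z₃) : Jet3))
    (fun v => coord_scale v s z₀ z₁ z₂ z₃) hp

/-! ### Jet coordinates of a field -/

/-- **Jet coordinates are partial derivatives**: for `|α| ≤ 3` the coordinate `∂^α v_a` of the abstract jet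
`(u x, Du x, D²u x, D³u x)` is `jetVal u x (a, α) = D^{|α|} u (x) (e_{α₁}, …) _a`. -/
theorem jetVal_eq_coord (u : EuclideanSpace ℝ (Fin 3) → EuclideanSpace ℝ (Fin 3)) (x : EuclideanSpace ℝ (Fin 3))
    (v : JVar) (hv : v.2.length ≤ 3) :
    jetVal u x v = JVar.coord v (u x, iteratedFDeriv ℝ 1 u x, iteratedFDeriv ℝ 2 u x, iteratedFDeriv ℝ 3 u x) := by
  obtain ⟨a, l⟩ := v
  match l, hv with
  | [], _ =>
    simp [jetVal, JVar.coord]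
  | [i], _ =>
    have h : (fun t : Fin [i].length => stdVec ([i].get t)) = fun _ => stdVec i := by
      funext t; fin_cases t; rfl
    simp only [jetVal, JVar.coord, h]
    rfl
  | [i, j], _ =>
    have h : (fun t : Fin [i, j].length => stdVec ([i, j].get t)) = ![stdVec i, stdVec j] := by
      funext t; fin_cases t <;> rfl
    simp only [jetVal, JVar.coord, h]
    rfl
  | [i, j, k], _ =>
    have h : (fun t : Fin [i, j, k].length => stdVec ([i, j, k].get t)) = ![stdVec i, stdVec j, stdVec k] := by
      funext t; fin_cases t <;> rfl
    simp only [jetVal, JVar.coord, h]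
    rfl
  | _ :: _ :: _ :: _ :: _, hv => exfalso; simp at hv; omega

/-- **Coordinates of order `≥ 4` vanish** on 3-jets. -/
theorem coord_eq_zero_of_le_length (v : JVar) (z : Jet3) (hv : 4 ≤ v.2.length) : JVar.coord v z = 0 := by
  obtain ⟨a, l⟩ := v
  match l, hv with
  | [], hv => simp at hv
  | [_], hv => simp at hv
  | [_, _], hv => simp at hv
  | [_, _, _], hv => simp at hv
  | _ :: _ :: _ :: _ :: _, _ => simp [JVar.coord]

/-! ### Assembly -/

/-- **Stub `dens_calculus`** (refutation of crux `OddMorawetzLocal`): the density of a jet polynomial is smooth,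
its Fréchet derivative is the linearisation `lin`, it is a cubic form when every monomial has three variables and
has weight `k` when every monomial has derivative weight `k`; the coordinates of the 3-jet of a field are its
partial derivatives, and coordinates of order `≥ 4` vanish. -/
theorem dens_calculus :
    (∀ p : JPoly ℝ, ContDiff ℝ (⊤ : ℕ∞) (JPoly.dens p)) ∧
    (∀ (p : JPoly ℝ) (z w : Jet3), fderiv ℝ (JPoly.dens p) z w = JPoly.lin p (fun v => JVar.coord v z) (fun v => JVar.coord v w)) ∧
    (∀ (p : JPoly ℝ), (∀ t ∈ p, t.2.length = 3) → ∀ (μ : ℝ) (z : Jet3), JPoly.dens p (μ • z) = μ ^ 3 * JPoly.dens p z) ∧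
    (∀ (p : JPoly ℝ) (k : ℕ), (∀ t ∈ p, monoWeight t.2 = k) → ∀ (s : ℝ), 0 < s →
      ∀ (z₀ : EuclideanSpace ℝ (Fin 3)) (z₁ : EuclideanSpace ℝ (Fin 3) [×1]→L[ℝ] EuclideanSpace ℝ (Fin 3))
        (z₂ : EuclideanSpace ℝ (Fin 3) [×2]→L[ℝ] EuclideanSpace ℝ (Fin 3))
        (z₃ : EuclideanSpace ℝ (Fin 3) [×3]→L[ℝ] EuclideanSpace ℝ (Fin 3)),
        JPoly.dens p (z₀, s • z₁, (s ^ 2) • z₂, (s ^ 3) • z₃) = s ^ k * JPoly.dens p (z₀, z₁, z₂, z₃)) ∧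
    (∀ (u : EuclideanSpace ℝ (Fin 3) → EuclideanSpace ℝ (Fin 3)) (x : EuclideanSpace ℝ (Fin 3)) (v : JVar),
      v.2.length ≤ 3 →
        jetVal u x v = JVar.coord v (u x, iteratedFDeriv ℝ 1 u x, iteratedFDeriv ℝ 2 u x, iteratedFDeriv ℝ 3 u x)) ∧
    (∀ (v : JVar) (z : Jet3), 4 ≤ v.2.length → JVar.coord v z = 0) :=
  ⟨contDiff_dens, fderiv_dens_apply, dens_smul, fun p k hp s _ => dens_weight p k hp s, jetVal_eq_coord,
    coord_eq_zero_of_le_length⟩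

end Summit.NavierStokesRegularity.NavierStokesRegularity.Theorems.OddMorawetz

end
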